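import Literature.Geometry.Riemannian.WassersteinW1OptimalCoupling
import Literature.Geometry.Riemannian.WassersteinW1Prokhorov
import Mathlib.MeasureTheory.Measure.FiniteMeasureProd
import HarnessLib

/-!
# The variance is lower semicontinuous under weak and `W₁`-convergence (Bamler 2023, §2.5,
# Lemma (a))

R. Bamler, *Compactness theory of the space of super Ricci flows*, Invent. Math. 233 (2023), §2.5,
the Lemma on `W₁`-limits: *"Consider a complete and separable metric space `(X, d)` and consider
probability measures `μᵢ ∈ 𝒫(X)`, `i = 1, 2, …, ∞`, with `μᵢ → μ_∞` in `W₁`. Then the following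
holds: (a) `Var(μ_∞) ≤ liminf_{i→∞} Var(μᵢ)`. … Proof. Assertion (a) is clear."* We supply the
"clear" argument: `W₁`-convergence implies weak convergence (`WassersteinW1Prokhorov.lean`),
`μ ↦ μ ⊗ μ` is weakly continuous (`MeasureTheory.ProbabilityMeasure.continuous_prod`), and
`q ↦ ∫ d² dq` is weakly lower semicontinuous (supremum of the weakly continuous
`q ↦ ∫ min(d², n) dq`):

* `lowerSemicontinuous_lintegral_of_continuous` — `q ↦ ∫ g dq` is weakly lsc for continuous
  `g ≥ 0` (generalizing `lowerSemicontinuous_lintegral_edist`);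
* `lowerSemicontinuous_variance` — `μ ↦ Var(μ)` is weakly lsc on `ProbabilityMeasure X`;
* `variance_le_liminf_of_tendsto`, `variance_le_liminf_of_tendsto_wassersteinW1` — **(a)**.

Everything is proved; no definitions, no named facts.

## References

* R. H. Bamler, *Compactness theory of the space of super Ricci flows*, Invent. Math. 233 (2023),
  §2.5, Lemma (W₁-limits: (a) lower semicontinuity of Var). [Bamler2023]
-/

noncomputable section

open Set MeasureTheory Filter Topology BoundedContinuousFunction
open scoped ENNReal NNReal

namespace Literature.Geometry.Riemannian

variable {Y : Type*} [TopologicalSpace Y] [MeasurableSpace Y] [OpensMeasurableSpace Y]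

/-- **`q ↦ ∫ g dq` is weakly lower semicontinuous** on `ProbabilityMeasure Y` for every continuous
`g : Y → ℝ≥0` (possibly unbounded): it is the supremum over `n` of the weakly continuous
`q ↦ ∫ min(g, n) dq`. [folklore] -/
theorem lowerSemicontinuous_lintegral_of_continuous {g : Y → ℝ≥0} (hg : Continuous g) :
    LowerSemicontinuous fun q : ProbabilityMeasure Y ↦ ∫⁻ y, (g y : ℝ≥0∞) ∂(q : Measure Y) := by
  -- the truncations as bounded continuous functions
  have hbd : ∀ (n : ℕ) (y y' : Y), dist (min (g y) (n : ℝ≥0)) (min (g y') (n : ℝ≥0)) ≤ n + n := by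
    intro n y y'
    rw [NNReal.dist_eq]
    have h1 : ((min (g y) n : ℝ≥0) : ℝ) ≤ n := by exact_mod_cast min_le_right _ _
    have h2 : ((min (g y') n : ℝ≥0) : ℝ) ≤ n := by exact_mod_cast min_le_right _ _
    have h3 : (0 : ℝ) ≤ (min (g y) n : ℝ≥0) := NNReal.coe_nonneg _
    have h4 : (0 : ℝ) ≤ (min (g y') n : ℝ≥0) := NNReal.coe_nonneg _
    rw [abs_le]
    constructor <;> linarith
  set f : ℕ → (Y →ᵇ ℝ≥0) := fun n ↦ BoundedContinuousFunction.mkOfBound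
    ⟨fun y ↦ min (g y) n, hg.min continuous_const⟩ (n + n) (hbd n) with hf_def
  have hf : ∀ (n : ℕ) (y : Y), ((f n y : ℝ≥0) : ℝ≥0∞) = min (g y : ℝ≥0∞) n := by
    intro n y
    simp only [hf_def, BoundedContinuousFunction.mkOfBound_coe, ContinuousMap.coe_mk,
      ENNReal.coe_min, ENNReal.coe_natCast]
  have hgm : Measurable fun y ↦ (g y : ℝ≥0∞) := (ENNReal.continuous_coe.comp hg).measurable
  have h : (fun q : ProbabilityMeasure Y ↦ ∫⁻ y, (g y : ℝ≥0∞) ∂(q : Measure Y)) =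
      fun q : ProbabilityMeasure Y ↦ ⨆ n : ℕ, ∫⁻ y, ((f n y : ℝ≥0) : ℝ≥0∞) ∂(q : Measure Y) := by
    funext q
    rw [← lintegral_iSup (fun n ↦ by fun_prop) (fun m n hmn y ↦ ?_)]
    · refine lintegral_congr fun y ↦ ?_
      simp_rw [hf]
      exact (iSup_min_natCast _).symm
    · simp only [hf]
      exact min_le_min le_rfl (by exact_mod_cast hmn)
  rw [h]
  exact lowerSemicontinuous_iSup fun n ↦
    (ProbabilityMeasure.continuous_lintegral_boundedContinuousFunction _).lowerSemicontinuous

variable {X : Type*} [MetricSpace X] [MeasurableSpace X] [BorelSpace X] [SecondCountableTopology X]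

/-- **The variance is weakly lower semicontinuous**: `μ ↦ Var(μ) = ∫ d² d(μ ⊗ μ)` on
`ProbabilityMeasure X` (the product map is weakly continuous,
`MeasureTheory.ProbabilityMeasure.continuous_prod`, and `q ↦ ∫ d² dq` is weakly lsc).
[cite: Bamler2023, §2.5, Lemma (W₁-limits), (a)] -/
theorem lowerSemicontinuous_variance :
    LowerSemicontinuous fun μ : ProbabilityMeasure X ↦ variance (μ : Measure X) (μ : Measure X) := by
  have hg : Continuous fun p : X × X ↦ nndist p.1 p.2 ^ 2 := (continuous_nndist.comp
    (continuous_fst.prodMk continuous_snd)).pow 2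
  have hlsc := lowerSemicontinuous_lintegral_of_continuous (Y := X × X) hg
  have hprod : Continuous fun μ : ProbabilityMeasure X ↦ μ.prod μ :=
    ProbabilityMeasure.continuous_prod.comp (continuous_id.prodMk continuous_id)
  have heq : (fun μ : ProbabilityMeasure X ↦ variance (μ : Measure X) (μ : Measure X)) =
      (fun q : ProbabilityMeasure (X × X) ↦ ∫⁻ p, ((nndist p.1 p.2 ^ 2 : ℝ≥0) : ℝ≥0∞) ∂(q : Measure (X × X)))
        ∘ fun μ : ProbabilityMeasure X ↦ μ.prod μ := by
    funext μ
    simp only [Function.comp_apply, ProbabilityMeasure.toMeasure_prod]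
    rw [variance_def, ← lintegral_prod _ (measurable_edist.pow_const 2).aemeasurable]
    refine lintegral_congr fun p ↦ ?_
    rw [ENNReal.coe_pow, edist_nndist]
  rw [heq]
  exact hlsc.comp hprod

/-- **(a) of the Lemma on `W₁`-limits, weak form**: if `μᵢ → μ` weakly then
`Var(μ) ≤ liminf Var(μᵢ)`. [cite: Bamler2023, §2.5, Lemma (W₁-limits), (a)] -/
theorem variance_le_liminf_of_tendsto {ι : Type*} {l : Filter ι} {μs : ι → ProbabilityMeasure X}
    {μ : ProbabilityMeasure X} (h : Tendsto μs l (𝓝 μ)) :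
    variance (μ : Measure X) (μ : Measure X) ≤
      liminf (fun i ↦ variance (μs i : Measure X) (μs i : Measure X)) l := by
  refine le_of_forall_lt_imp_le_of_dense fun b hb ↦ le_liminf_of_le (h := ?_)
  exact (h.eventually (lowerSemicontinuous_variance μ b hb)).mono fun i hi ↦ hi.le

/-- **(a) of the Lemma on `W₁`-limits** (Bamler 2023, §2.5): on a complete separable metric space,
if `d_{W₁}(μᵢ, μ_∞) → 0` then `Var(μ_∞) ≤ liminf_{i→∞} Var(μᵢ)`.
[cite: Bamler2023, §2.5, Lemma (W₁-limits), (a)] -/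
theorem variance_le_liminf_of_tendsto_wassersteinW1 {ι : Type*} {l : Filter ι}
    {μs : ι → ProbabilityMeasure X} {μ : ProbabilityMeasure X}
    (h : Tendsto (fun i ↦ wassersteinW1 (μs i : Measure X) (μ : Measure X)) l (𝓝 0)) :
    variance (μ : Measure X) (μ : Measure X) ≤
      liminf (fun i ↦ variance (μs i : Measure X) (μs i : Measure X)) l :=
  variance_le_liminf_of_tendsto (ProbabilityMeasure.tendsto_of_tendsto_wassersteinW1 h)

end Literature.Geometry.Riemannian

end
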